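import Literature.MathematicalPhysics.QuantumFieldTheory.Balaban1983to89.B1Ineq224RegularTorus
import Literature.MathematicalPhysics.QuantumFieldTheory.Balaban1983to89.B1Prop21ZeroField

/-!
# `Balaban1983to89.B1Prop21RegularTorusFam` — T. Bałaban, *(Higgs)₂,₃ quantum fields in a finite volume. I. A lower bound*,
# Commun. Math. Phys. **85** (1982) 603–626 [Balaban1982Higgs1]: **PROPOSITION 2.1 (2.23)–(2.26), THE TYPED LEAF `B1.Prop21Printed` IN ITS
# RULED READING `0 ≦ α < 1`, INHABITED BY THE (Higgs)₂,₃ CARRIER'S OWN OPERATORS** — the propagator (2.20)/(2.22)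
# `G^ε_K(T_ε, A) = (−Δ^{ε,N}_{A,T_ε} + m² + a_K(L^Kε)^{−2}P_K(A))^{−1}` of `HiggsCovariance` and the covariant derivative (1.7) of `HiggsLattice` —
# AT EVERY (2.23)-REGULAR VECTOR FIELD `A`, on `Ω = Ω₀ = T_ε` («paper we will use the case Ω = T_ε only», p. 610 L1), every torus of the
# carrier, every level: the family `regTorusFam` of `B4.EtaSetting`s and `prop21NN_regTorusFam` (from gen 11's `B1Ineq225RegularTorus` /
# `B1Ineq224RegularTorus` through p14's bridge `prop21NN_iff_thmPrintedNN`)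

statement-level skeleton of published theorems with citation tags; proofs where landed; nothing here is a claim about the Yang–Mills mass gap

PDF held: `paper:balaban1982-cmp85-higgs23-i` pp. 604–605, 610–611 [PDF 2–3, 8–9] (×2 renders p003/p008/p009 re-read by this seat);
`paper:balaban1983-cmp89-regularity-decay` pp. 572–573 [PDF 2–3].

CITATION HEADER (lean-in-tree rule).  Cell `lit-balaban` (HOME `run/shared/lean/pub/lit-balaban/`), Phase-2 proof seat **p35** gen 11 (unit
`lit-balaban-p35`); SKELETON row **B1.Prop2.1** (decl of record `…B1.Prop21Printed`, pv07, UNCHANGED; fold owners r01/r14, referee ref-4), xref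
B4.Thm@573; kind «model instance»: the typed leaf on a family built from the CONCRETE carrier (as p14's `B1Prop22ZeroFieldTorusFam` / r14's
`B1Prop22ZeroFieldRegionFam` did for Prop. 2.2 at zero field).  USED BY NAME: this seat's gen-11 theorems
`B1Ineq225RegularTorus.{norm_propagatorK_reg_decay, norm_covDeriv_propagatorK_reg_decay}` and `B1Ineq224RegularTorus.norm_holder_propagatorK_reg_decay`
(the three clauses with decay at every regular `A` on `T_ε`), p14 gen 8's `B1Prop21ZeroField.prop21NN_iff_thmPrintedNN`, pv17's
`B4Ineq111ZeroNestEta.ThmPrintedNN`, pv07's `B1.{Ineq224_225, Ineq226}`, gen 10's `B1TorusChainTransport.{IsTChain, hol}`, the typer's carriers.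
WHAT IS PRINTED (I p. 610 [PDF 8], verbatim from the ×2 render): *"**Proposition 2.1.** Let a set Ω satisfies Ω = B^k(Ω^{(k)}) and let Ω^{(k)} ⊂ T₁^{(k)}
be a sum of big blocks with M sufficiently large. Further, let a configuration A be regular on Ω in the sense that |(∂^η_μA)(x)| ≦ c(e(L^kε))^{β−1},
x ∈ Ω, μ = 1,…,d, (2.23) where e(L^kε) = e(L^kε)^{(4−d)/2}, η = L^{−k}, β > 0 and c is some universal constant. For an arbitrary pair of points
x, x′ ∈ T_η let us denote yb [sic] Γ_{x,x′} a shortest contour connecting these points. Then for e(L^kε) sufficiently small and α < 1 there exist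
positive constants δ₀, c₀, R₀ independent of A, k, Ω and depending on d, a, M only, c₀ on α also, such that for an arbitrary function f : Ω → R^N
we have (1/|x − x′|^α)|U(A(Γ_{x,x′}))(D^η_{A,μ}G_k(Ω, A)f)(x′) − (D^η_{A,μ}G_k(Ω, A)f)(x)| ≦ c₀ exp(−δ₀ dist({x, x′}, supp f))‖f‖_∞ (2.24) for x, x′ ∈ Ω
and satisfying the condition dist({x, x′}, Ω^c) ≧ R₀. Similarly we have |(D^η_{A,μ}G_k(Ω, A)f)(x)|, |(G_k(Ω, A)f)(x)| ≦ c₀ exp(−δ₀ dist(x, supp f))‖f‖_∞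
(2.25) for x ∈ Ω, dist(x, Ω^c) ≧ R₀. If Ω ⊂ Ω₀, then for δG_k(Ω, Ω₀, A) defined by the equality δG_k(Ω, Ω₀, A) = G_k(Ω, A) − G_k(Ω₀, A), (2.26) we
have the inequalities (2.24), (2.25) with the additional factor exp(−δ₀ dist(supp f, Ω^c) − δ₀ dist({x, x′}, Ω^c))"*, p. 611: *"on the right sides.
… Let us notice that Ω^c means a complement in T_η, so in the case Ω = T_η the condition dist({x, x′}, Ω^c) ≧ R₀ is meaningless and is omitted."*;
p. 610 L1: *"paper we will use the case Ω = T_ε only"*; (2.22): *"G_k(Ω, A) = (−Δ^{η,N}_{A,Ω} + m²(L^kε)² + a_kP_k(A))^{−1}"*.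

THE FAMILY (`regTorusFam d L C a m² ε₀ c β K₀`; definitions with bodies).  Parameters: dimension `d` and `L` of the carrier's tori, the charge
data `(e, q)` (`U(A) = exp(qεeA)`, [B1] (1.7)), `a`, `m²`, a mesh cap `ε₀`, the (2.23) pair `(c, β)`, the cube size `K₀` (the print's `M`).  A
MEMBER `i : RegTorusIdx d L ε₀` is a torus `P` of the carrier (`P.d = d`, `P.L = L`), a level `1 ≦ K ≦ K_P` with `L^Kε ≦ ε₀`, a vector field `A` on
the bonds of `T_ε` and an effective coupling `e_K` (member coordinate; the printed normalisation is `e_K = e(L^Kε) = e(L^Kε)^{(4−d)/2}`, for which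
`regular` below is (2.23) to the letter — the family is the union over all normalisations, and the clauses hold on all of it).  FIELDS (the printed
objects of Prop. 2.1 for `Ω = Ω₀ = T_ε` at level `K`, in `η = L^{−K}`-units): `e := e_K`; `regular :=` (2.23) bond by bond,
`(L^Kε|e|/e_K)|A_ν(x + εe_μ) − A_ν(x)| ≦ c·e_K^{β−1}/L^K`; `bigBlocks := K₀ ∣ M ∧ 3K₀ ≦ 2M` (the torus `T₁^{(K)}` is a union of the random-walk cubes
with room — «with M sufficiently large»); `rect := True` and `bdist1 = bdist2 = bdistS := 0` (`Ω^c = ∅`: «meaningless and is omitted»); `sdist1 x f =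
dist(x, supp f)`, `sdist2 = dist({x,x′}, supp f)` (lattice-step distance (1.3) divided by `L^K`; `0` for `f = 0`); `supNorm = ‖·‖_∞`;
`valG f x = |(G_K f)(x)| := ‖(G^ε_K(T_ε,A)f)(x)‖/(L^Kε)²` and `valDG μ f x := ‖(D^ε_AG^ε_Kf)(⟨x,μ⟩)‖/(L^Kε)` (the rescaling (2.20) ↔ (2.22):
`G_K = (L^Kε)^{−2}G^ε_K`, `D^η = (L^Kε)D^ε`); `lhs19 α μ f x x′ := sup_Γ (|x − x′|/L^K)^{−α}‖U(A(Γ))(D^ε_AG^ε_Kf)(⟨x′,μ⟩) − (D^ε_AG^ε_Kf)(⟨x,μ⟩)‖/(L^Kε)`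
over the admissible contours `Γ` = nearest-neighbour chains from `x` to `x′ ≠ x` with `|Γ| ≦ d|x − x′|` (`0` if none); the `δ`-fields are the same
functionals of `δG_K(T_ε, T_ε, A) = G_K − G_K` (2.26); `lower18 γ :=` (1.8) `γ‖φ‖² ≦ (L^Kε)²⟨φ, (−Δ^{ε,N}_A + a_K(L^Kε)^{−2}P_K(A))φ⟩`; `pair`,
`dpair` (the Cor. 2.3 functionals) are NOT MODELLED (set to `0`: `B4.Cor23Printed` on this family is meaningless and NOT claimed).
WHAT THIS FILE PROVES (kernel-checked, zero `sorry`; axioms standard).  **`thmPrintedNN_regTorusFam`** / **`prop21NN_regTorusFam`**: for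
`d ≧ 1`, `L ≧ 2`, `a > 0`, `m² > 0`, `N`, `(e,q)`, `ε₀`, `c ≧ 0`, `β > 0` there is `K₀min` such that for every cube size `K₀ ≧ K₀min` the ruled
reading of Prop. 2.1 (pv17's `ThmPrintedNN` ≡ `B1.Prop21Printed` with `0 ≦ α`: `∀ 0 ≦ α < 1 ∃ δ₀ c₀ R₀ e₁ > 0 ∀ members, regular → bigBlocks →
0 < e_K ≦ e₁ → Ineq224_225 ∧ Ineq226`) HOLDS on `regTorusFam d L C a m² ε₀ c β K₀`; `regTorusFam_nonvacuous` (members meeting all antecedents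
below every threshold); the `δ`-clauses hold because `δG_K(T_ε,T_ε,A) = 0` (`deltaG_eq_zero`).
HONEST SCOPE.  `Ω = Ω₀ = T_ε` only (general big-block regions of `T_ε` at `A ≠ 0` are not in the tree for this carrier — they need
[Balaban1983RegularityDecay] Lemma 2.1 at boundary cubes for the composite contours (2.11)); `m² > 0` ([B1] p. 605) with the cap `L^Kε ≦ ε₀`
in the index; `L ≧ 2`; constants existential (functions of the parameters and of `K₀`; `c₀, e₁, δ₀` also of `α`); the literal leaf «∀ α < 1» is
not asserted (range defect at `A = 0` booked in `B1Prop21ZeroField`).  Unit `lit-balaban-p35` gen 11 (literature-prover-lit-balaban-p35-g11-0).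
-/

open scoped BigOperators

noncomputable section

namespace Literature.MathematicalPhysics.QuantumFieldTheory.Balaban1983to89.B1Prop21RegularTorusFam

open Literature.MathematicalPhysics.QuantumFieldTheory.Balaban1983to89.HiggsLattice (ChargeData covDeriv siteInner)
open Literature.MathematicalPhysics.QuantumFieldTheory.Balaban1983to89.HiggsCovariance (propagatorK covOpK)
open Literature.MathematicalPhysics.QuantumFieldTheory.Balaban1983to89.B1 (Ineq224_225 Ineq226)
open Literature.MathematicalPhysics.QuantumFieldTheory.Balaban1983to89.B4 (EtaSetting Ineq19_110 Ineq111_112)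
open Literature.MathematicalPhysics.QuantumFieldTheory.Balaban1983to89.B4Ineq111ZeroNestEta (ThmPrintedNN)
open Literature.MathematicalPhysics.QuantumFieldTheory.Balaban1983to89.B1Prop21ZeroField (prop21NN_iff_thmPrintedNN)
open Literature.MathematicalPhysics.QuantumFieldTheory.Balaban1983to89.B4GaugeCovariance (pathEnd)
open Literature.MathematicalPhysics.QuantumFieldTheory.Balaban1983to89.B1TorusChainTransport (IsTChain hol)
open Literature.MathematicalPhysics.QuantumFieldTheory.Balaban1983to89.B1Ineq225RegularTorus (norm_propagatorK_reg_decay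
  norm_covDeriv_propagatorK_reg_decay)
open Literature.MathematicalPhysics.QuantumFieldTheory.Balaban1983to89.B1Ineq224RegularTorus (norm_holder_propagatorK_reg_decay)

/-! ## §1 The members and the printed functionals on the carrier -/

/-- A MEMBER of the family: a torus of the carrier with `P.d = d`, `P.L = L`, a level `1 ≦ K ≦ K_P` with the mesh cap `L^Kε ≦ ε₀`, a vector
field `A` on the bonds of `T_ε`, and the effective coupling `e_K` (print: `e(L^kε) = e(L^kε)^{(4−d)/2}`; any positive normalisation).
[cite: Balaban1982Higgs1, Prop. 2.1 (2.23) p.610] -/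
structure RegTorusIdx (d L : ℕ) (ε₀ : ℝ) where
  /-- the torus of the carrier -/
  P : HiggsLattice.Params
  hPd : P.d = d
  hPL : P.L = L
  /-- the level -/
  K : ℕ
  hK1 : 1 ≤ K
  hK : K ≤ P.K
  hε : P.mesh K ≤ ε₀
  /-- the vector field on the bonds of `T_ε` -/
  A : HiggsLattice.VecField P 0
  /-- the effective coupling `e_K` -/
  ec : ℝ

variable {d L N : ℕ} {ε₀ : ℝ}

namespace RegTorusIdx

variable (i : RegTorusIdx d L ε₀) (C : ChargeData N) (a msq : ℝ)

open Classical in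
/-- `supp f` ⊂ `T_ε`. [cite: Balaban1982Higgs1, (2.24)–(2.25) p.610 «supp f», dictionary] -/
def supp (f : HiggsLattice.ScalarField i.P 0 N) : Finset (HiggsLattice.Site i.P 0) := Finset.univ.filter fun z => f z ≠ 0

/-- `dist(x, supp f)` in lattice steps of `T_ε` (the (1.3) torus distance; `0` for `f = 0`). [cite: Balaban1982Higgs1, (2.25) p.610 «dist(x, supp f)», (1.3) p.604] -/
def sdistL (x : HiggsLattice.Site i.P 0) (f : HiggsLattice.ScalarField i.P 0 N) : ℝ :=
  if h : (i.supp f).Nonempty then (((i.supp f).inf' h fun z => HiggsLattice.Site.tdist x z : ℕ) : ℝ) else 0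

/-- `dist(supp f, supp f′)` in lattice steps (`0` if a support is empty). [cite: Balaban1982Higgs1, (2.27) p.611, dictionary] -/
def ssdistL (f f' : HiggsLattice.ScalarField i.P 0 N) : ℝ :=
  if h : (i.supp f ×ˢ i.supp f').Nonempty then
    (((i.supp f ×ˢ i.supp f').inf' h fun p => HiggsLattice.Site.tdist p.1 p.2 : ℕ) : ℝ) else 0

/-- ADMISSIBLE CONTOURS `Γ_{x,x′}` («a shortest contour connecting these points», read as: a nearest-neighbour chain from `x` to `x′ ≠ x` with
`|Γ| ≦ d·|x − x′|`). [cite: Balaban1982Higgs1, Prop. 2.1 p.610 «Γ_{x,x′} a shortest contour»] -/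
def TAdm (x x' : HiggsLattice.Site i.P 0) (l : List (HiggsLattice.Site i.P 0)) : Prop :=
  x' ≠ x ∧ IsTChain x l ∧ pathEnd x l = x' ∧ (l.length : ℝ) ≤ (i.P.d : ℝ) * HiggsLattice.Site.tdist x x'

/-- THE HÖLDER QUOTIENT (left side of (2.24)) of a bond field `w` in direction `μ`, in `η`-units:
`sup_Γ (|x − x′|/L^K)^{−α}‖U(A(Γ))w(⟨x′,μ⟩) − w(⟨x,μ⟩)‖/(L^Kε)` over the admissible contours (`0` if there is none, e.g. `x′ = x`).
[cite: Balaban1982Higgs1, (2.24) p.610] -/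
def holderQ (α : ℝ) (μ : Fin i.P.d) (w : HiggsLattice.PBond i.P 0 → EuclideanSpace ℝ (Fin N)) (x x' : HiggsLattice.Site i.P 0) : ℝ :=
  ⨆ (l : List (HiggsLattice.Site i.P 0)), ⨆ (_ : i.TAdm x x' l),
    (((HiggsLattice.Site.tdist x x' : ℝ) / (i.P.L : ℝ) ^ i.K)⁻¹) ^ α * (‖hol C i.A x l (w ⟨x', μ⟩) - w ⟨x, μ⟩‖ / i.P.mesh i.K)

/-- `G^ε_K(T_ε, A)` (2.20) of the member. [cite: Balaban1982Higgs1, (2.20) p.610] -/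
abbrev G (f : HiggsLattice.ScalarField i.P 0 N) : HiggsLattice.ScalarField i.P 0 N := propagatorK C Finset.univ i.A msq a i.K f

/-- `δG_K(Ω, Ω₀, A)f = G_K(Ω,A)f − G_K(Ω₀,A)f` (2.26) of the member, `Ω = Ω₀ = T_ε`. [cite: Balaban1982Higgs1, (2.26) p.610] -/
def deltaG (f : HiggsLattice.ScalarField i.P 0 N) : HiggsLattice.ScalarField i.P 0 N := i.G C a msq f - i.G C a msq f

/-- `δG_K(T_ε, T_ε, A) = 0`. [cite: Balaban1982Higgs1, (2.26) p.610] -/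
theorem deltaG_eq_zero (f : HiggsLattice.ScalarField i.P 0 N) : i.deltaG C a msq f = 0 := sub_self _

/-- a bound on every admissible quotient bounds the Hölder quotient. [cite: Balaban1982Higgs1, (2.24) p.610, dictionary] -/
theorem holderQ_le {α : ℝ} {μ : Fin i.P.d} {w : HiggsLattice.PBond i.P 0 → EuclideanSpace ℝ (Fin N)} {x x' : HiggsLattice.Site i.P 0}
    {b : ℝ} (hb : 0 ≤ b)
    (h : ∀ l, i.TAdm x x' l →
      (((HiggsLattice.Site.tdist x x' : ℝ) / (i.P.L : ℝ) ^ i.K)⁻¹) ^ α * (‖hol C i.A x l (w ⟨x', μ⟩) - w ⟨x, μ⟩‖ / i.P.mesh i.K) ≤ b) :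
    i.holderQ C α μ w x x' ≤ b :=
  Real.iSup_le (fun l => Real.iSup_le (fun hl => h l hl) hb) hb

/-- the support distance is attained below every point of the support. [cite: Balaban1982Higgs1, (2.25) p.610, dictionary] -/
theorem sdistL_le {x z : HiggsLattice.Site i.P 0} {f : HiggsLattice.ScalarField i.P 0 N} (hz : f z ≠ 0) :
    i.sdistL x f ≤ (HiggsLattice.Site.tdist x z : ℝ) := by
  classical
  have hmem : z ∈ i.supp f := by unfold supp; exact Finset.mem_filter.2 ⟨Finset.mem_univ _, hz⟩
  have hne : (i.supp f).Nonempty := ⟨z, hmem⟩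
  unfold sdistL
  rw [dif_pos hne]
  exact_mod_cast Finset.inf'_le _ hmem

/-- the support distance is non-negative. [cite: Balaban1982Higgs1, (2.25) p.610, dictionary] -/
theorem sdistL_nonneg (x : HiggsLattice.Site i.P 0) (f : HiggsLattice.ScalarField i.P 0 N) : 0 ≤ i.sdistL x f := by
  unfold sdistL; split_ifs <;> positivity

end RegTorusIdx

/-- the covariant derivative of the zero scalar field vanishes. [cite: Balaban1982Higgs1, (1.7) p.605] -/
private theorem covDeriv_apply_zero {P : HiggsLattice.Params} (C : ChargeData N) (A : HiggsLattice.VecField P 0) (b : HiggsLattice.PBond P 0) :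
    covDeriv C A (0 : HiggsLattice.ScalarField P 0 N) b = 0 := by
  unfold covDeriv; simp

/-! ## §2 The family of settings -/

/-- **THE FAMILY OF SETTINGS OF PROP. 2.1 BUILT FROM THE (Higgs)₂,₃ CARRIER AT EVERY (2.23)-REGULAR FIELD, `Ω = Ω₀ = T_ε`** (module docstring
«THE FAMILY» for the reading of each field). [cite: Balaban1982Higgs1, Prop. 2.1 (2.23)–(2.26) pp.610–611; (2.20), (2.22) p.610] -/
def regTorusFam (d L : ℕ) (C : ChargeData N) (a msq ε₀ creg β : ℝ) (K₀ : ℕ) (i : RegTorusIdx d L ε₀) : EtaSetting where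
  Site := HiggsLattice.Site i.P 0
  Dir := Fin i.P.d
  Src := HiggsLattice.ScalarField i.P 0 N
  e := i.ec
  regular := ∀ (x : HiggsLattice.Site i.P 0) (μ ν : Fin i.P.d),
    i.P.mesh i.K * |C.e| / i.ec * |i.A ⟨x.shift μ, ν⟩ - i.A ⟨x, ν⟩| ≤ creg * i.ec ^ (β - 1) / (i.P.L : ℝ) ^ i.K
  bigBlocks := K₀ ∣ i.P.M ∧ 3 * K₀ ≤ 2 * i.P.M
  rect := True
  pdist := fun x y => (HiggsLattice.Site.tdist x y : ℝ) / (i.P.L : ℝ) ^ i.K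
  sdist1 := fun x f => i.sdistL x f / (i.P.L : ℝ) ^ i.K
  sdist2 := fun x x' f => min (i.sdistL x f) (i.sdistL x' f) / (i.P.L : ℝ) ^ i.K
  bdist1 := fun _ => 0
  bdist2 := fun _ _ => 0
  bdistS := fun _ => 0
  supNorm := fun f => ‖f‖
  l2Norm := fun f => Real.sqrt (siteInner f f)
  ssdist := fun f f' => i.ssdistL f f' / (i.P.L : ℝ) ^ i.K
  lhs19 := fun α μ f x x' => i.holderQ C α μ (covDeriv C i.A (i.G C a msq f)) x x'
  valDG := fun μ f x => ‖covDeriv C i.A (i.G C a msq f) ⟨x, μ⟩‖ / i.P.mesh i.K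
  valG := fun f x => ‖i.G C a msq f x‖ / i.P.mesh i.K ^ 2
  dlhs19 := fun α μ f x x' => i.holderQ C α μ (covDeriv C i.A (i.deltaG C a msq f)) x x'
  dvalDG := fun μ f x => ‖covDeriv C i.A (i.deltaG C a msq f) ⟨x, μ⟩‖ / i.P.mesh i.K
  dvalG := fun f x => ‖i.deltaG C a msq f x‖ / i.P.mesh i.K ^ 2
  lower18 := fun γ => ∀ φ : HiggsLattice.ScalarField i.P 0 N,
    γ * siteInner φ φ ≤ i.P.mesh i.K ^ 2 * siteInner φ (covOpK C Finset.univ i.A 0 a i.K φ)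
  pair := fun _ _ _ _ _ => 0
  dpair := fun _ _ _ _ _ => 0

/-! ## §3 The typed leaf on the family -/

/-- exponential weights compare: `c ≦ c′`, `δ′ ≦ δ`, `s ≧ 0` ⇒ `c·e^{−δs}M ≦ c′·e^{−δ′s}M`. [folklore] -/
private theorem weight_mono {c c' δ δ' s M : ℝ} (hc : c ≤ c') (hc' : 0 ≤ c') (hδ : δ' ≤ δ) (hs : 0 ≤ s) (hM : 0 ≤ M) :
    c * Real.exp (-(δ * s)) * M ≤ c' * Real.exp (-(δ' * s)) * M := by
  have h1 : Real.exp (-(δ * s)) ≤ Real.exp (-(δ' * s)) := Real.exp_le_exp.2 (by nlinarith)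
  have h2 : c * Real.exp (-(δ * s)) ≤ c' * Real.exp (-(δ' * s)) :=
    (mul_le_mul_of_nonneg_right hc (Real.exp_nonneg _)).trans (mul_le_mul_of_nonneg_left h1 hc')
  exact mul_le_mul_of_nonneg_right h2 hM

set_option maxHeartbeats 800000 in
/-- **B4's THEOREM p. 573 IN pv17's TYPED `η`-UNIFORM FORM `ThmPrintedNN` HOLDS ON THE CARRIER FAMILY `regTorusFam`**: for `d ≧ 1`, `L ≧ 2`,
`a > 0`, `m² > 0`, `N`, `(e, q)`, `ε₀`, `c ≧ 0`, `β > 0` there is a cube size `K₀min` such that for every `K₀ ≧ K₀min`: for every `0 ≦ α < 1` there are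
`δ₀, c₀, R₀, e₁ > 0` such that every member (torus, level, field `A`, coupling `e_K`) which is (2.23)-regular, whose torus satisfies `K₀ ∣ M`,
`3K₀ ≦ 2M`, and with `0 < e_K ≦ e₁` satisfies (2.24)–(2.25) = (1.9)–(1.10) and the (2.26) = (1.11)–(1.12) clauses (the latter with `δG = 0`).
Assembly of `norm_propagatorK_reg_decay`, `norm_covDeriv_propagatorK_reg_decay`, `norm_holder_propagatorK_reg_decay` (minimum of the three rates and
thresholds, maximum of the three constants, `R₀ = 1`). [cite: Balaban1982Higgs1, Prop. 2.1 (2.23)–(2.26) pp.610–611]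
[cite: Balaban1983RegularityDecay, Theorem (1.9)–(1.12) p.573] -/
theorem thmPrintedNN_regTorusFam (d L : ℕ) (hL : 2 ≤ L) {a : ℝ} (ha : 0 < a) {msq : ℝ} (hmsq : 0 < msq) (C : ChargeData N) (ε₀ : ℝ)
    (creg β : ℝ) (hcreg : 0 ≤ creg) (hβ : 0 < β) :
    ∃ K₀min : ℕ, ∀ K₀ : ℕ, K₀min ≤ K₀ → ThmPrintedNN (regTorusFam d L C a msq ε₀ creg β K₀) := by
  obtain ⟨c₁, hc₁, K₁, e₁, δ₁, h₁, H₁⟩ := norm_propagatorK_reg_decay d L hL ha hmsq N C ε₀ creg β hcreg hβ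
  obtain ⟨c₂, hc₂, K₂, e₂, δ₂, h₂, H₂⟩ := norm_covDeriv_propagatorK_reg_decay d L hL ha hmsq N C ε₀ creg β hcreg hβ
  obtain ⟨K₃, H₃⟩ := norm_holder_propagatorK_reg_decay d L hL ha hmsq N C ε₀ creg β hcreg hβ
  refine ⟨max (max K₁ K₂) K₃, fun K₀ hK₀ => ?_⟩
  have hK₁ : K₁ ≤ K₀ := le_trans (le_trans (le_max_left _ _) (le_max_left _ _)) hK₀
  have hK₂ : K₂ ≤ K₀ := le_trans (le_trans (le_max_right _ _) (le_max_left _ _)) hK₀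
  have hK₃ : K₃ ≤ K₀ := le_trans (le_max_right _ _) hK₀
  intro α hα0 hα1
  obtain ⟨c₃, hc₃, e₃, δ₃, h₃, H₃'⟩ := H₃ hα0 hα1
  set δ₀ : ℝ := min (min (δ₁ K₀) (δ₂ K₀)) (δ₃ K₀) with hδ₀
  set c₀ : ℝ := max (max c₁ c₂) c₃ with hc₀
  set eth : ℝ := min (min (e₁ K₀) (e₂ K₀)) (e₃ K₀) with heth
  have hδ₀pos : 0 < δ₀ := lt_min (lt_min (h₁ K₀).2 (h₂ K₀).2) (h₃ K₀).2
  have hc₀pos : 0 < c₀ := lt_of_lt_of_le hc₁ ((le_max_left _ _).trans (le_max_left _ _))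
  have hethpos : 0 < eth := lt_min (lt_min (h₁ K₀).1 (h₂ K₀).1) (h₃ K₀).1
  refine ⟨δ₀, c₀, 1, eth, hδ₀pos, hc₀pos, one_pos, hethpos, ?_⟩
  intro i hreg hbig hec hle
  dsimp only [regTorusFam] at hreg hbig hec hle
  obtain ⟨hK₀M, h3M⟩ := hbig
  have hle₁ : i.ec ≤ e₁ K₀ := hle.trans ((min_le_left _ _).trans (min_le_left _ _))
  have hle₂ : i.ec ≤ e₂ K₀ := hle.trans ((min_le_left _ _).trans (min_le_right _ _))
  have hle₃ : i.ec ≤ e₃ K₀ := hle.trans (min_le_right _ _)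
  have hδ₁ : δ₀ ≤ δ₁ K₀ := (min_le_left _ _).trans (min_le_left _ _)
  have hδ₂ : δ₀ ≤ δ₂ K₀ := (min_le_left _ _).trans (min_le_right _ _)
  have hδ₃ : δ₀ ≤ δ₃ K₀ := min_le_right _ _
  have hcc₁ : c₁ ≤ c₀ := (le_max_left _ _).trans (le_max_left _ _)
  have hcc₂ : c₂ ≤ c₀ := (le_max_right _ _).trans (le_max_left _ _)
  have hcc₃ : c₃ ≤ c₀ := le_max_right _ _
  have hmesh : 0 < i.P.mesh i.K := i.P.mesh_pos i.K
  have hLK : (0 : ℝ) < (i.P.L : ℝ) ^ i.K := by have := i.P.hL; positivity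
  -- the three clauses at the member, for a source `f` and the distances `D = L^K·sdist`
  have HV := fun (f : HiggsLattice.ScalarField i.P 0 N) (x : HiggsLattice.Site i.P 0) =>
    H₁ K₀ hK₁ i.P i.hPd i.hPL hK₀M h3M i.hK1 i.hK i.hε i.A hec hle₁ hreg f ‖f‖ (i.sdistL x f) (fun y => norm_le_pi_norm f y)
      (i.sdistL_nonneg x f) x (fun z hz => i.sdistL_le hz)
  have HD := fun (f : HiggsLattice.ScalarField i.P 0 N) (b : HiggsLattice.PBond i.P 0) =>
    H₂ K₀ hK₂ i.P i.hPd i.hPL hK₀M h3M i.hK1 i.hK i.hε i.A hec hle₂ hreg f ‖f‖ (i.sdistL b.src f) (fun y => norm_le_pi_norm f y)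
      (i.sdistL_nonneg b.src f) b (fun z hz => i.sdistL_le hz)
  have HH := fun (f : HiggsLattice.ScalarField i.P 0 N) (μ : Fin i.P.d) (x x' : HiggsLattice.Site i.P 0) (hne : x' ≠ x)
      (l : List (HiggsLattice.Site i.P 0)) (hch : IsTChain x l) (hend : pathEnd x l = x')
      (hlen : (l.length : ℝ) ≤ (i.P.d : ℝ) * HiggsLattice.Site.tdist x x') =>
    H₃' K₀ hK₃ i.P i.hPd i.hPL hK₀M h3M i.hK1 i.hK i.hε i.A hec hle₃ hreg f ‖f‖ (min (i.sdistL x f) (i.sdistL x' f))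
      (fun y => norm_le_pi_norm f y) (le_min (i.sdistL_nonneg x f) (i.sdistL_nonneg x' f)) μ x x' hne l hch hend hlen
      (fun z hz => (min_le_left _ _).trans (i.sdistL_le hz)) (fun z hz => (min_le_right _ _).trans (i.sdistL_le hz))
  have hf0 : ∀ f : HiggsLattice.ScalarField i.P 0 N, 0 ≤ ‖f‖ := fun f => norm_nonneg f
  refine ⟨⟨?_, ?_⟩, ⟨?_, ?_⟩⟩
  · -- (2.24) / (1.9): the Hölder quotient
    dsimp only [regTorusFam]
    intro μ f x x' _
    refine i.holderQ_le C (by positivity) fun l hl => ?_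
    obtain ⟨hne, hch, hend, hlen⟩ := hl
    have h := HH f μ x x' hne l hch hend hlen
    have hs : 0 ≤ min (i.sdistL x f) (i.sdistL x' f) / (i.P.L : ℝ) ^ i.K :=
      div_nonneg (le_min (i.sdistL_nonneg x f) (i.sdistL_nonneg x' f)) hLK.le
    rw [← mul_div_assoc, div_le_iff₀ hmesh]
    calc (((HiggsLattice.Site.tdist x x' : ℝ) / (i.P.L : ℝ) ^ i.K)⁻¹) ^ α *
          ‖hol C i.A x l (covDeriv C i.A (i.G C a msq f) ⟨x', μ⟩) - covDeriv C i.A (i.G C a msq f) ⟨x, μ⟩‖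
        ≤ c₃ * i.P.mesh i.K * Real.exp (-(δ₃ K₀ * (min (i.sdistL x f) (i.sdistL x' f) / (i.P.L : ℝ) ^ i.K))) * ‖f‖ := h
      _ = c₃ * Real.exp (-(δ₃ K₀ * (min (i.sdistL x f) (i.sdistL x' f) / (i.P.L : ℝ) ^ i.K))) * ‖f‖ * i.P.mesh i.K := by ring
      _ ≤ c₀ * Real.exp (-(δ₀ * (min (i.sdistL x f) (i.sdistL x' f) / (i.P.L : ℝ) ^ i.K))) * ‖f‖ * i.P.mesh i.K :=
          mul_le_mul_of_nonneg_right (weight_mono hcc₃ hc₀pos.le hδ₃ hs (hf0 f)) hmesh.le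
  · -- (2.25) / (1.10): the derivative and the value member
    dsimp only [regTorusFam]
    intro μ f x _
    have hs : 0 ≤ i.sdistL x f / (i.P.L : ℝ) ^ i.K := div_nonneg (i.sdistL_nonneg x f) hLK.le
    refine ⟨?_, ?_⟩
    · have h := HD f ⟨x, μ⟩
      rw [div_le_iff₀ hmesh]
      calc ‖covDeriv C i.A (i.G C a msq f) ⟨x, μ⟩‖
          ≤ c₂ * i.P.mesh i.K * Real.exp (-(δ₂ K₀ * (i.sdistL x f / (i.P.L : ℝ) ^ i.K))) * ‖f‖ := h
        _ = c₂ * Real.exp (-(δ₂ K₀ * (i.sdistL x f / (i.P.L : ℝ) ^ i.K))) * ‖f‖ * i.P.mesh i.K := by ring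
        _ ≤ c₀ * Real.exp (-(δ₀ * (i.sdistL x f / (i.P.L : ℝ) ^ i.K))) * ‖f‖ * i.P.mesh i.K :=
            mul_le_mul_of_nonneg_right (weight_mono hcc₂ hc₀pos.le hδ₂ hs (hf0 f)) hmesh.le
    · have h := HV f x
      rw [div_le_iff₀ (pow_pos hmesh 2)]
      calc ‖i.G C a msq f x‖
          ≤ c₁ * i.P.mesh i.K ^ 2 * Real.exp (-(δ₁ K₀ * (i.sdistL x f / (i.P.L : ℝ) ^ i.K))) * ‖f‖ := h
        _ = c₁ * Real.exp (-(δ₁ K₀ * (i.sdistL x f / (i.P.L : ℝ) ^ i.K))) * ‖f‖ * i.P.mesh i.K ^ 2 := by ring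
        _ ≤ c₀ * Real.exp (-(δ₀ * (i.sdistL x f / (i.P.L : ℝ) ^ i.K))) * ‖f‖ * i.P.mesh i.K ^ 2 :=
            mul_le_mul_of_nonneg_right (weight_mono hcc₁ hc₀pos.le hδ₁ hs (hf0 f)) (pow_pos hmesh 2).le
  · -- (2.26) / (1.11)–(1.12): `δG = 0`, Hölder functional
    dsimp only [regTorusFam]
    intro μ f x x' _
    refine i.holderQ_le C (by positivity) fun l _ => ?_
    rw [i.deltaG_eq_zero C a msq f, covDeriv_apply_zero, covDeriv_apply_zero, map_zero, sub_self, norm_zero, zero_div, mul_zero]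
    positivity
  · -- `δG = 0`, derivative and value member
    dsimp only [regTorusFam]
    intro μ f x _
    refine ⟨?_, ?_⟩
    · rw [i.deltaG_eq_zero C a msq f, covDeriv_apply_zero, norm_zero, zero_div]
      positivity
    · rw [i.deltaG_eq_zero C a msq f, Pi.zero_apply, norm_zero, zero_div]
      positivity

/-- **PROPOSITION 2.1, RULED READING `0 ≦ α < 1`, HOLDS FOR THE (Higgs)₂,₃ CARRIER'S OWN OPERATORS AT EVERY (2.23)-REGULAR FIELD ON
`Ω = Ω₀ = T_ε`**: for `d ≧ 1`, `L ≧ 2`, `a > 0`, `m² > 0`, `N`, `(e,q)`, `ε₀`, `c ≧ 0`, `β > 0` there is `K₀min` («M sufficiently large») such that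
for every `K₀ ≧ K₀min` and every `0 ≦ α < 1` there are `δ₀, c₀, R₀, e₁ > 0` with: every member of `regTorusFam d L C a m² ε₀ c β K₀` — every torus,
every level `1 ≦ K ≦ K_P` with `L^Kε ≦ ε₀`, EVERY vector field `A` regular in the sense (2.23), torus with `K₀ ∣ M`, `3K₀ ≦ 2M`, coupling
`0 < e_K ≦ e₁` («e(L^kε) sufficiently small») — satisfies (2.24)–(2.25) (`B1.Ineq224_225`) and (2.26) (`B1.Ineq226`) for `G^ε_K(T_ε, A)` of (2.20)
rescaled as (2.22).  p14's bridge `prop21NN_iff_thmPrintedNN` applied to `thmPrintedNN_regTorusFam`.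
[cite: Balaban1982Higgs1, Prop. 2.1 (2.23)–(2.26) pp.610–611] -/
theorem prop21NN_regTorusFam (d L : ℕ) (hL : 2 ≤ L) {a : ℝ} (ha : 0 < a) {msq : ℝ} (hmsq : 0 < msq) (C : ChargeData N) (ε₀ : ℝ)
    (creg β : ℝ) (hcreg : 0 ≤ creg) (hβ : 0 < β) :
    ∃ K₀min : ℕ, ∀ K₀ : ℕ, K₀min ≤ K₀ →
      ∀ α : ℝ, 0 ≤ α → α < 1 → ∃ δ₀ c₀ R₀ e₁ : ℝ, 0 < δ₀ ∧ 0 < c₀ ∧ 0 < R₀ ∧ 0 < e₁ ∧ ∀ i : RegTorusIdx d L ε₀,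
        (regTorusFam d L C a msq ε₀ creg β K₀ i).regular → (regTorusFam d L C a msq ε₀ creg β K₀ i).bigBlocks →
        0 < (regTorusFam d L C a msq ε₀ creg β K₀ i).e → (regTorusFam d L C a msq ε₀ creg β K₀ i).e ≤ e₁ →
          Ineq224_225 (regTorusFam d L C a msq ε₀ creg β K₀ i) α δ₀ c₀ R₀ ∧ Ineq226 (regTorusFam d L C a msq ε₀ creg β K₀ i) α δ₀ c₀ R₀ := by
  obtain ⟨K₀min, h⟩ := thmPrintedNN_regTorusFam d L hL ha hmsq C ε₀ creg β hcreg hβ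
  exact ⟨K₀min, fun K₀ hK₀ => (prop21NN_iff_thmPrintedNN _).2 (h K₀ hK₀)⟩

/-- **Non-vacuity**: for `d ≧ 1`, `L ≧ 2`, `ε₀ > 0`, `c ≧ 0`, every cube size `K₀ ≧ 1` and every threshold `e₁ > 0` the family has a member meeting
all four antecedents (`regular`, `bigBlocks`, `0 < e_K ≦ e₁`): the torus with `M = 2K₀`, `L′_μ = 1`, `K_P = K = 1`, `ε = ε₀/L`, at `A = 0`,
`e_K = e₁`. [cite: Balaban1982Higgs1, Prop. 2.1 p.610, dictionary] -/
theorem regTorusFam_nonvacuous {d L : ℕ} (hd : 1 ≤ d) (hL : 2 ≤ L) (C : ChargeData N) (a msq : ℝ) {ε₀ : ℝ} (hε₀ : 0 < ε₀)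
    {creg : ℝ} (hcreg : 0 ≤ creg) (β : ℝ) {K₀ : ℕ} (hK₀ : 1 ≤ K₀) {e₁ : ℝ} (he₁ : 0 < e₁) :
    ∃ i : RegTorusIdx d L ε₀,
      (regTorusFam d L C a msq ε₀ creg β K₀ i).regular ∧ (regTorusFam d L C a msq ε₀ creg β K₀ i).bigBlocks ∧
      0 < (regTorusFam d L C a msq ε₀ creg β K₀ i).e ∧ (regTorusFam d L C a msq ε₀ creg β K₀ i).e ≤ e₁ := by
  have hL0 : 0 < L := by omega
  have hLr : (0 : ℝ) < L := by exact_mod_cast hL0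
  have hmesh : HiggsLattice.Params.mesh ⟨d, ε₀ / L, 1, L, 2 * K₀, fun _ => 1, hd, div_pos hε₀ hLr, hL0, by omega, fun _ => one_pos⟩ 1
      ≤ ε₀ := by
    show (L : ℝ) ^ 1 * (ε₀ / L) ≤ ε₀
    rw [pow_one, mul_div_cancel₀ _ hLr.ne']
  refine ⟨⟨⟨d, ε₀ / L, 1, L, 2 * K₀, fun _ => 1, hd, div_pos hε₀ hLr, hL0, by omega, fun _ => one_pos⟩, rfl, rfl, 1, le_rfl, le_rfl,
    hmesh, 0, e₁⟩, ?_, ?_, he₁, le_rfl⟩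
  · dsimp only [regTorusFam]
    intro x μ ν
    rw [Pi.zero_apply, Pi.zero_apply, sub_self, abs_zero, mul_zero]
    positivity
  · show K₀ ∣ 2 * K₀ ∧ 3 * K₀ ≤ 2 * (2 * K₀)
    exact ⟨Dvd.intro_left 2 rfl, by omega⟩

end Literature.MathematicalPhysics.QuantumFieldTheory.Balaban1983to89.B1Prop21RegularTorusFam

end
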